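import Summits.CriticalPhenomena.CardyFormulaZ2.Theorems.CardyComplexConeEdgePrecompactShiftStabilityReduction
import Literature.Probability.LatticeModels.DartPhase

/-!
# The linear local envelope implies (X1)
(line `qkz-strip-boundary-arm` of crux `CardyComplexCone.EdgePrecompact`, stmt-CriticalPhenomena-11387; lead c2,
reshape r4 — bookkeeping for the disprover and the planners)

The registered open core `stub_localInnerEnvelopeUI` (X1) is the uniform-integrability TAIL form of a local
envelope: `∀ ε₁ > 0 ∃ ε' > 0`, `P(A) ≤ ε' ⇒ ‖E[F_{v,f} ; A]‖ ≤ ε₁ (E.δ/ρ)^{1/3}` for events `A` measurable off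
the ball `B(δv, ρ) ⊆ E.Ω`. This file records the elementary implication from the LINEAR local envelope
"`‖E[F_{v,f} ; A]‖ ≤ C · P(A) · (E.δ/ρ)^{1/3}` for every such `A`" (equivalently: the conditional expectation of
the spin-`1/3` dart phase sum given the configuration off the ball is a.s. bounded by `C (E.δ/ρ)^{1/3}`), which is
the statement a Monte-Carlo adversary can attack by fixing the exterior and sampling the interior:
`localInnerEnvelopeUI_of_linearLocalEnvelope` (take `ε' = ε₁ / (|C| + 1)`). Together with the landed thinning
lemma `uniformInnerEnvelope_of_localInnerEnvelopeUI` (X1 ⇒ the unconditional envelope) this brackets X1 between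
the linear local envelope and clause (i) of the crux. (X1 is NOT claimed equivalent to the linear form: with
`φ(p) := sup {‖E[F;A]‖ (ρ/E.δ)^{1/3} : P(A) ≤ p}`, X1 says `φ(p) → 0`, the linear form says `φ(p) ≤ C p`, and
thinning only gives `φ(p 2^{-k}) ≥ 2^{-k} φ(p)`.)

References: H. Duminil-Copin, S. Smirnov, Clay Math. Proc. 15 (2012), §8 (spin-`1/3` observable, Conj. 8.7).
-/

namespace Summit.CriticalPhenomena.CardyFormulaZ2.Cruxes.EdgePrecompact.QkzStripBoundaryArm

open MeasureTheory Filter Set Metric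
open scoped Topology BigOperators Pointwise
open Literature.Probability.LatticeModels Literature.Probability.Percolation
open Literature.Probability.RandomPlanarGeometry (DobrushinDomain)
open Summit.CriticalPhenomena.CardyFormulaZ2.Theses.CardyComplexCone

noncomputable section

/-- **The linear local envelope implies (X1).** HYPOTHESIS: one constant `C` with
`‖∫_A F_{v,f}‖ ≤ C · P(A) · (E.δ/ρ)^{1/3}` for every admissible datum, corner, ball `closedBall (δv) ρ ⊆ E.Ω`
(`ρ ≥ E.δ`) and every event `A` measurable off the ball. CONCLUSION: the registered stub `stub_localInnerEnvelopeUI`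
(X1) verbatim. Proof: `ε' := ε₁ / (|C| + 1)`. -/
theorem localInnerEnvelopeUI_of_linearLocalEnvelope : (∃ C : ℝ, ∀ (E : DiscreteDobrushin), E.IsZdAdmissible → ∀ v f : Site 2, IsCorner v f → ∀ ρ : ℝ, E.δ ≤ ρ → closedBall (meshPoint E.δ v) ρ ⊆ E.Ω → ∀ A : Set (BondConfig (Site 2)), MeasurableSet[MeasurableSpace.comap (fun ω : BondConfig (Site 2) => ω \ {e | medialPoint E.δ e ∈ ball (meshPoint E.δ v) ρ}) (inferInstance : MeasurableSpace (BondConfig (Site 2)))] A → ‖∫ ω in A, dartPhaseSum (medialExploration E ω) E.δ (1 / 3) (v, f) ∂(bondPercolation (zdGraph 2) half)‖ ≤ C * (bondPercolation (zdGraph 2) half).real A * (E.δ / ρ) ^ ((1:ℝ) / 3)) → ∀ ε₁ > (0:ℝ), ∃ ε' > (0:ℝ), ∀ (E : DiscreteDobrushin), E.IsZdAdmissible → ∀ v f : Site 2, IsCorner v f → ∀ ρ : ℝ, E.δ ≤ ρ → closedBall (meshPoint E.δ v) ρ ⊆ E.Ω → ∀ A : Set (BondConfig (Site 2)), MeasurableSet[MeasurableSpace.comap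 (fun ω : BondConfig (Site 2) => ω \ {e | medialPoint E.δ e ∈ ball (meshPoint E.δ v) ρ}) (inferInstance : MeasurableSpace (BondConfig (Site 2)))] A → (bondPercolation (zdGraph 2) half).real A ≤ ε' → ‖∫ ω in A, dartPhaseSum (medialExploration E ω) E.δ (1 / 3) (v, f) ∂(bondPercolation (zdGraph 2) half)‖ ≤ ε₁ * (E.δ / ρ) ^ ((1:ℝ) / 3) := by
  rintro ⟨C, hC⟩ ε₁ hε₁
  refine ⟨ε₁ / (|C| + 1), by positivity, fun E hE v f hvf ρ hρ hball A hA hPA => ?_⟩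
  have hδ : 0 < E.δ := hE.delta_pos
  have hρpos : 0 < ρ := lt_of_lt_of_le hδ hρ
  have hr : 0 ≤ (E.δ / ρ) ^ ((1:ℝ) / 3) := Real.rpow_nonneg (div_nonneg hδ.le hρpos.le) _
  have hP0 : 0 ≤ (bondPercolation (zdGraph 2) half).real A := measureReal_nonneg
  have key := hC E hE v f hvf ρ hρ hball A hA
  have h1 : C * (bondPercolation (zdGraph 2) half).real A ≤ |C| * (ε₁ / (|C| + 1)) :=
    (mul_le_mul_of_nonneg_right (le_abs_self C) hP0).trans (mul_le_mul_of_nonneg_left hPA (abs_nonneg C))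
  have h2 : |C| * (ε₁ / (|C| + 1)) ≤ ε₁ := by
    rw [mul_div_assoc']
    rw [div_le_iff₀ (by positivity)]
    nlinarith [abs_nonneg C]
  calc ‖∫ ω in A, dartPhaseSum (medialExploration E ω) E.δ (1 / 3) (v, f) ∂(bondPercolation (zdGraph 2) half)‖
      ≤ C * (bondPercolation (zdGraph 2) half).real A * (E.δ / ρ) ^ ((1:ℝ) / 3) := key
    _ ≤ ε₁ * (E.δ / ρ) ^ ((1:ℝ) / 3) := mul_le_mul_of_nonneg_right (h1.trans h2) hr

end

end Summit.CriticalPhenomena.CardyFormulaZ2.Cruxes.EdgePrecompact.QkzStripBoundaryArm
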